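import Mathlib
import HarnessLib
import Summits.NavierStokesRegularity.NavierStokesRegularity.Theorems.PoloidalWindowDoorLrcModEntireQ4SonicCurved
import Summits.NavierStokesRegularity.NavierStokesRegularity.Theorems.PoloidalWindowDoorLrcModEntireCurvedSheetUniqueness
import Summits.NavierStokesRegularity.NavierStokesRegularity.Theorems.PoloidalWindowDoorLrcModEntireHorizontalPeriod

/-!
# Route `PoloidalWindowDoor`, item `LrcModEntire` (stmt-NavierStokesRegularity-20428), cell (Q4-curved) of the (TH) column —
# THE PERIODIC SUB-CASE IS EMPTY: a curved limit branch with PERIODIC CURVATURE (equivalently: a translation period) is impossible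

Cell ns-regularity-ideate, stub-worker seat ns-poloidal-K2-p2 g16 under the LEAD of item 20428 (ns-poloidal-K2-p3 g17);
`--supports stmt-NavierStokesRegularity-20428 --as helper`.  Memo `Cruxes/LrcModEntire/T2B-g16.md` §3–§4/§6 («its PERIODIC sub-case is dead on paper:
discrete period + the tree's axially-periodic Type-I Liouville theorem»; docstring of the registered `stub_Q4curved`, twist_split v11/v12) — now in the kernel.

* `q4curved_translation_core` — hypotheses = those of `…Q4SonicCurved.q4sonic_curved_core` (the (Q4) package conjuncts the proof uses, `F = σ·U₂(−1+τ,·)`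
  substituted; `Γ` not a line) WITHOUT the sonic literal (neither it nor its negation is needed), plus a TRANSLATION PERIOD of the limit branch
  `Γ(s+L) = Γ(s) + τ⃗` (`L ≠ 0`) ⊢ `False`.  PROOF.  `τ⃗ = Γ(L) ≠ 0` is horizontal (`…Q4LimitBranchProper.limitBranch_injective_proper`); the curved web
  package (`…CurvedWebPackage`) gives the offset `d`, Frenet curvature `k`, `κ(z) > 0`, HUYGENS `κ d′² = R″ − μκ` and the PARALLEL WEBS on `|z| < δ₂`;
  `w := U₂(−1,·+τ⃗) − U₂(−1,·)` is real-analytic, solves the slice law `∂₂²w = −μ(x₂)Δₕw` on the slope slab (`plane_wave_identity`, translation), and has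
  ZERO CAUCHY DATA on the parallel-web sheet `{Γ s + d(z)JΓ′(s) + z e₂}` (values: parallel webs; gradients: horizontal criticality + the web Fermat law through
  port-2's `webData_of_fderiv_uncurry`, the sheet being `τ⃗`-invariant).  DICHOTOMY: (A) some height `|z₀| < δ₂` is non-characteristic, `d′(z₀)² + μ(z₀) ≠ 0` —
  then `…CurvedSheetUniqueness.eqOn_zero_nhds_of_sheet` makes `w ≡ 0` near a sheet point and port-2's `…HorizontalPeriod.false_of_local_horizontalPeriod_slab`
  ends it; (B) every height is characteristic — then Huygens gives `R″ ≡ 0` on `(−δ₂,δ₂)`, `R(0,·)` is affine there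
  (`…Q4LineTools.affine_of_deriv_deriv_eq_zero`), and `q4sonic_curved_core` (this seat, p736277) applied on the window `δ₂` ends it.
* ★ `q4curved_periodic_core` — the same with the period stated on the SIGNED CURVATURE `⟪Γ″, νΓ⟫` (`∃ L ≠ 0, ∀ s, ⟪Γ″(s+L), νΓ(s+L)⟫ = ⟪Γ″(s), νΓ(s)⟫`):
  periodic curvature + properness of the limit branch ⇒ a translation period (`…PlanarCurveRigidity.exists_translation_period_of_tendsto`, this seat p733032,
  + `limitBranch_injective_proper`, p733052) ⇒ `q4curved_translation_core`.

RESIDUE of (Q4-curved) after this file (memo T2B-g16 §4, T2B-g17 §3): APERIODIC recurrent curvature.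
WHAT THIS IS NOT: not a claim about Navier–Stokes regularity; a sub-case of one research slot of line twist_split closes (bears_on LADDER-NS N0 via item 20428;
items 20428 / 19708 / 27893 OPEN).
-/

noncomputable section

-- the summit and its single sub-problem share the name (CONVENTIONS §1), as in every Theorems file
set_option linter.dupNamespace false

namespace Summit.NavierStokesRegularity.NavierStokesRegularity.Theorems.PoloidalWindowDoorLrcModEntireQ4CurvedPeriodic

open Set Function Filter Topology Metric
open scoped RealInnerProductSpace InnerProductSpace ContDiff
open Literature.Analysis Literature.Analysis.FluidPDE Literature.Analysis.UnboundedOperators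
open Summit.NavierStokesRegularity.NavierStokesRegularity.Theorems.PoloidalWindowDoorLrcModEntireSheetFlattenTools
open Summit.NavierStokesRegularity.NavierStokesRegularity.Theorems.PoloidalWindowDoorLrcModEntireQ4LineTools
open Summit.NavierStokesRegularity.NavierStokesRegularity.Theorems.PoloidalWindowDoorLrcModEntireParallelWebsIdentity
open Summit.NavierStokesRegularity.NavierStokesRegularity.Theorems.PoloidalWindowDoorLrcModEntireRidgeWebLaw
open Summit.NavierStokesRegularity.NavierStokesRegularity.Theorems.PoloidalWindowDoorLrcModEntireThreadPins
open Summit.NavierStokesRegularity.NavierStokesRegularity.Theorems.PoloidalWindowDoorPoloidalWindowRigidityTimeHeightShearLinearSlice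
open Summit.NavierStokesRegularity.NavierStokesRegularity.Theorems.PoloidalWindowDoorPoloidalWindowRigidityConstantShearSlice
open Summit.NavierStokesRegularity.NavierStokesRegularity.Theorems.LocalSineTubeDoorProfileAlignedWindowRigidityAncient
open Summit.NavierStokesRegularity.NavierStokesRegularity.Theorems.PoloidalWindowDoorLrcModEntireRidgeGlobalBranchODE
open Summit.NavierStokesRegularity.NavierStokesRegularity.Theorems.PoloidalWindowDoorLrcModEntireRidgeGlobalBranchFrame
open Summit.NavierStokesRegularity.NavierStokesRegularity.Theorems.PoloidalWindowDoorLrcModEntirePlanarCurveRigidity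
open Summit.NavierStokesRegularity.NavierStokesRegularity.Theorems.PoloidalWindowDoorLrcModEntireQ4LimitBranchProper
open Summit.NavierStokesRegularity.NavierStokesRegularity.Theorems.PoloidalWindowDoorLrcModEntireCurvedWebHuygens
open Summit.NavierStokesRegularity.NavierStokesRegularity.Theorems.PoloidalWindowDoorLrcModEntireCurvedWebPackage
open Summit.NavierStokesRegularity.NavierStokesRegularity.Theorems.PoloidalWindowDoorLrcModEntireQ4SonicCurved
open Summit.NavierStokesRegularity.NavierStokesRegularity.Theorems.PoloidalWindowDoorLrcModEntireCurvedSheetUniqueness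
open Summit.NavierStokesRegularity.NavierStokesRegularity.Theorems.PoloidalWindowDoorLrcModEntireHorizontalPeriod

/-! ### Tools -/

/-- Nested second derivatives of a translation difference: `∂_a∂_b(θ(·+τ) − θ)(x) = ∂_a∂_bθ(x+τ) − ∂_a∂_bθ(x)`. -/
theorem nested_translate_sub {θ : EuclideanSpace ℝ (Fin 3) → ℝ} (hθ : ContDiff ℝ 2 θ) (τ x a b : EuclideanSpace ℝ (Fin 3)) :
    fderiv ℝ (fun y => fderiv ℝ (fun y' => θ (y' + τ) - θ y') y b) x a =
      fderiv ℝ (fun y => fderiv ℝ θ y b) (x + τ) a - fderiv ℝ (fun y => fderiv ℝ θ y b) x a := by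
  have hθd : Differentiable ℝ θ := hθ.differentiable (by norm_num)
  have hτd : Differentiable ℝ (fun y' : EuclideanSpace ℝ (Fin 3) => θ (y' + τ)) := hθd.comp (differentiable_id.add_const τ)
  have h1 : (fun y => fderiv ℝ (fun y' => θ (y' + τ) - θ y') y b) = fun y => fderiv ℝ θ (y + τ) b - fderiv ℝ θ y b := by
    funext y
    rw [fderiv_fun_sub (hτd y) (hθd y), fderiv_comp_add_right]
    rfl
  rw [h1]
  have hg : Differentiable ℝ (fun y => fderiv ℝ θ y b) :=
    ((hθ.fderiv_right (m := 1) (by norm_cast)).clm_apply contDiff_const).differentiable (by norm_cast)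
  have hgτ : Differentiable ℝ (fun y => fderiv ℝ θ (y + τ) b) := hg.comp (differentiable_id.add_const τ)
  have e2 : fderiv ℝ (fun y => fderiv ℝ θ (y + τ) b) x = fderiv ℝ (fun y => fderiv ℝ θ y b) (x + τ) :=
    fderiv_comp_add_right (f := fun y => fderiv ℝ θ y b) τ
  rw [fderiv_fun_sub (hgτ x) (hg x), e2]
  rfl

/-- Two linear forms on `ℝ³` agreeing on the coordinate vectors are equal. -/
theorem clm_eq_of_apply_single {A B : EuclideanSpace ℝ (Fin 3) →L[ℝ] ℝ}
    (h : ∀ i : Fin 3, A (EuclideanSpace.single i (1 : ℝ)) = B (EuclideanSpace.single i (1 : ℝ))) : A = B := by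
  ext v
  rw [PoloidalWindowDoorLrcModEntireRidgeWebLaw.eq_sum_single v]
  simp only [map_add, map_smul, h]

/-! ### The translation-periodic curved branch -/

/-- **(Q4-CURVED), TRANSLATION-PERIODIC BRANCH ⇒ `False`.**  See the module docstring. -/
theorem q4curved_translation_core {C : ℝ} {U : ℝ → EuclideanSpace ℝ (Fin 3) → EuclideanSpace ℝ (Fin 3)} {Γ νΓ : ℝ → EuclideanSpace ℝ (Fin 3)}
    {R μ : ℝ → ℝ → ℝ} {σ κ r δ ρ : ℝ}
    (hUrate : HasTypeITimeDecay C U) (hUcont : ContinuousOn (uncurry U) (Iio (0 : ℝ) ×ˢ univ))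
    (hUmild : ∀ s t : ℝ, s < t → t < 0 → ∀ x, U t x = heatExtension (U s) (t - s) x - oseenDuhamel 1 s U U t x)
    (hUdiv : ∀ t < 0, VectorCalculus.IsDivFree (U t))
    (hUpol : ∀ s < 0, ∀ q, ⟪curl (U s) q, EuclideanSpace.single 2 1⟫_ℝ = 0)
    (hUne : U (-1) 0 2 ≠ 0) (hUhotbd : ∀ t < 0, ∀ x, Real.sqrt (-t) * |U t x 2| ≤ |U (-1) 0 2|)
    (hUpeak : ∀ (s z₀ σ M : ℝ) (K O : Set (EuclideanSpace ℝ (Fin 3))), s < 0 →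
      ((σ = 1 ∨ σ = -1) ∧ IsCompact K ∧ K.Nonempty ∧ (∀ q ∈ K, q 2 = z₀ ∧ σ * U s q 2 = M) ∧
        IsOpen O ∧ K ⊆ O ∧ (∀ q ∈ O, q 2 = z₀ → σ * U s q 2 ≤ M) ∧
        (∀ q ∈ O, q 2 = z₀ → σ * U s q 2 = M → q ∈ K)) → False)
    (hUcrit : ∀ y ∈ {y : EuclideanSpace ℝ (Fin 3) | y 2 = 0 ∧ U (-1) y 2 = U (-1) 0 2}, fderiv ℝ (fun x => U (-1) x 2) y = 0)
    (hσ : σ = 1 ∨ σ = -1) (hσN : σ * U (-1) 0 2 = |U (-1) 0 2|) (hκ : 0 < κ)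
    (hΓ : ContDiff ℝ ∞ Γ) (hΓ0 : Γ 0 = 0) (hΓ2 : ∀ s, Γ s 2 = 0) (hΓunit : ∀ s, ‖deriv Γ s‖ = 1) (hΓhot : ∀ s, U (-1) (Γ s) 2 = U (-1) 0 2)
    (hν : ∀ s, νΓ s = WithLp.toLp 2 ![-(deriv Γ s 1), deriv Γ s 0, 0])
    (hΓcurv : ∀ s, κ ≤ -(fderiv ℝ (fderiv ℝ (fun y => σ * U (-1) y 2)) (Γ s) (νΓ s) (νΓ s)))
    (hr : 0 < r) (hδ : 0 < δ)
    (hconc : ∀ τ z : ℝ, |τ| < δ → |z| < δ → ∀ s : ℝ, ∀ n ∈ Ioo (-r) r,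
      fderiv ℝ (fderiv ℝ (fun y => σ * U (-1 + τ) y 2)) (Γ s + n • νΓ s + z • EuclideanSpace.single 2 (1 : ℝ)) (νΓ s) (νΓ s) < 0)
    (hweb : ∀ τ₀ z₀ : ℝ, |τ₀| < δ → |z₀| < δ → ∀ s₀ : ℝ, ∃ n₀ ∈ Ioo (-r) r,
      σ * U (-1 + τ₀) (Γ s₀ + n₀ • νΓ s₀ + z₀ • EuclideanSpace.single 2 (1 : ℝ)) 2 = R τ₀ z₀ ∧
      (∀ n ∈ Icc (-r) r, n ≠ n₀ → σ * U (-1 + τ₀) (Γ s₀ + n • νΓ s₀ + z₀ • EuclideanSpace.single 2 (1 : ℝ)) 2 < R τ₀ z₀) ∧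
      DifferentiableAt ℝ (uncurry R) (τ₀, z₀) ∧
      fderiv ℝ (uncurry fun τ y => σ * U (-1 + τ) y 2) (τ₀, Γ s₀ + n₀ • νΓ s₀ + z₀ • EuclideanSpace.single 2 (1 : ℝ)) =
        (fderiv ℝ (uncurry R) (τ₀, z₀)).comp
          ((ContinuousLinearMap.fst ℝ ℝ (EuclideanSpace ℝ (Fin 3))).prod
            ((EuclideanSpace.proj (2 : Fin 3)).comp (ContinuousLinearMap.snd ℝ ℝ (EuclideanSpace ℝ (Fin 3))))))
    (hρ : 0 < ρ) (hμ3 : ContDiff ℝ 3 (uncurry μ))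
    (hslabU : ∀ t : ℝ, |t + 1| < ρ → ∀ x : EuclideanSpace ℝ (Fin 3), |x 2| < ρ → ∀ b : Fin 3, b ≠ 2 →
      fderiv ℝ (U t) x (EuclideanSpace.single 2 1) b = μ t (x 2) * fderiv ℝ (U t) x (EuclideanSpace.single b 1) 2)
    (hevU : ∀ t₀ : ℝ, |t₀ + 1| < ρ → ∀ y₀ : EuclideanSpace ℝ (Fin 3), y₀ 2 = 0 →
      ∀ᶠ z in 𝓝 ((t₀, y₀) : ℝ × EuclideanSpace ℝ (Fin 3)), ∀ b : Fin 3, b ≠ 2 →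
        fderiv ℝ (U z.1) z.2 (EuclideanSpace.single 2 1) b = μ z.1 (z.2 2) * fderiv ℝ (U z.1) z.2 (EuclideanSpace.single b 1) 2)
    (hcurved : ¬ (∀ s : ℝ, Γ s = s • deriv Γ 0))
    (hper : ∃ (L : ℝ) (τ : EuclideanSpace ℝ (Fin 3)), L ≠ 0 ∧ ∀ s, Γ (s + L) = Γ s + τ) : False := by
  have hm1 : (-1 : ℝ) < 0 := by norm_num
  have h0δ : |(0 : ℝ)| < δ := by simpa using hδ
  have hσ0 : σ ≠ 0 := by rcases hσ with h | h <;> simp [h]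
  have habs : ∀ {a : ℝ} {z : ℝ}, z ∈ Ioo (-a) a ↔ |z| < a := fun {a z} => by rw [mem_Ioo, abs_lt]
  /- STEP 1: analyticity of the slice, `θ = U₂(−1,·)`. -/
  have hUan : AnalyticOnNhd ℝ (U (-1)) univ := analyticOnNhd_slice hUcont (bdd_of_hasTypeITimeDecay hUrate) hUmild hm1
  have hU2 : ContDiff ℝ 2 (U (-1)) := hUan.contDiff
  have hUd : Differentiable ℝ (U (-1)) := hU2.differentiable (by norm_num)
  have hθan : AnalyticOnNhd ℝ (fun y => U (-1) y 2) univ := fun x _ =>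
    ((EuclideanSpace.proj (𝕜 := ℝ) (2 : Fin 3)).analyticAt _).comp (hUan x (mem_univ _))
  have hθ2 : ContDiff ℝ 2 (fun y => U (-1) y 2) := hθan.contDiff
  have hΓc2 : ContDiff ℝ 2 Γ := hΓ.of_le (by norm_cast)
  have hνJ : ∀ s, νΓ s = rotJ (deriv Γ s) := fun s => by rw [hν s]; rfl
  have hμc : Continuous (μ (-1)) := hμ3.continuous.comp (continuous_const.prodMk continuous_id)
  /- STEP 2: the curved web package. -/
  obtain ⟨δ₂, d, κf, k, K, hδ₂, hδ₂δ, hδ₂ρ, hk, hkd, hkK, hd0, hdCD, hdwin, hRCD, hκfd, hκf0, hwin, hHuy, hpar, hhoriz, hnconc, hridge,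
    hslice⟩ :=
    curved_web_package hUrate hUcont hUmild hUdiv hUpol hUne hUhotbd hUcrit hσ hσN hκ hΓ hΓ2 hΓunit hΓhot hν hΓcurv hr hδ hconc hweb hρ hμ3
      hslabU hevU
  have hIδ : Ioo (-δ₂) δ₂ ⊆ Ioo (-δ) δ := fun z hz => ⟨by linarith [hz.1], by linarith [hz.2]⟩
  /- STEP 3: the period `τ⃗ = Γ(L) ≠ 0`, horizontal; the frame is `L`-periodic. -/
  obtain ⟨L, τ, hL, hperΓ⟩ := hper
  have hτΓ : τ = Γ L := by have h := hperΓ 0; rw [zero_add, hΓ0, zero_add] at h; exact h.symm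
  have hτh : τ 2 = 0 := by rw [hτΓ]; exact hΓ2 L
  have hinj := limitBranch_injective_proper hUrate hUcont hUmild hUdiv hUpol hUne hUhotbd hUpeak hUcrit hσ hσN hκ hΓc2 hΓ2 hΓunit hΓhot hν
    hΓcurv hρ hμ3 hevU
  have hτ0 : τ ≠ 0 := by
    intro h
    apply hL
    apply hinj.1
    rw [← hτΓ, h, hΓ0]
  have hTper : ∀ s, deriv Γ (s + L) = deriv Γ s := by
    intro s
    have h1 : deriv (fun s' => Γ (s' + L)) s = deriv Γ (s + L) := deriv_comp_add_const _ _ _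
    have h2 : (fun s' => Γ (s' + L)) = fun s' => Γ s' + τ := funext hperΓ
    rw [h2, deriv_add_const] at h1
    exact h1.symm
  have hPper : ∀ s z : ℝ, Γ (s + L) + d z • rotJ (deriv Γ (s + L)) + z • e2 = (Γ s + d z • rotJ (deriv Γ s) + z • e2) + τ := by
    intro s z; rw [hTper, hperΓ]; abel
  /- STEP 4: `w = θ(· + τ⃗) − θ`, analytic; the slice law on the slope slab. -/
  set w : EuclideanSpace ℝ (Fin 3) → ℝ := fun y => U (-1) (y + τ) 2 - U (-1) y 2 with hw_def
  have hwan : AnalyticOnNhd ℝ w univ := by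
    intro x _
    have hsh : AnalyticAt ℝ (fun y : EuclideanSpace ℝ (Fin 3) => y + τ) x := analyticAt_id.add analyticAt_const
    exact ((hθan (x + τ) (mem_univ _)).comp_of_eq hsh rfl).sub (hθan x (mem_univ _))
  have hslabU1 : ∀ x : EuclideanSpace ℝ (Fin 3), |x 2| < ρ → ∀ b : Fin 3, b ≠ 2 →
      fderiv ℝ (U (-1)) x (EuclideanSpace.single 2 1) b = μ (-1) (x 2) * fderiv ℝ (U (-1)) x (EuclideanSpace.single b 1) 2 :=
    fun x hx b hb => hslabU (-1) (by simp [hρ]) x hx b hb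
  have hplane : ∀ z : ℝ, |z| < ρ → ∀ y : EuclideanSpace ℝ (Fin 3), y 2 = z → ∀ b : Fin 3, b ≠ 2 →
      fderiv ℝ (U (-1)) y (EuclideanSpace.single 2 (1 : ℝ)) b = μ (-1) z * fderiv ℝ (U (-1)) y (EuclideanSpace.single b (1 : ℝ)) 2 := by
    intro z hz y hy b hb
    have h := hslabU1 y (by rw [hy]; exact hz) b hb
    rw [hy] at h; exact h
  have hlawθ : ∀ x : EuclideanSpace ℝ (Fin 3), |x 2| < ρ →
      fderiv ℝ (fun y => fderiv ℝ (fun y' => U (-1) y' 2) y (EuclideanSpace.single 2 (1 : ℝ))) x (EuclideanSpace.single 2 (1 : ℝ)) =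
        -μ (-1) (x 2) * (fderiv ℝ (fun y => fderiv ℝ (fun y' => U (-1) y' 2) y (EuclideanSpace.single 0 (1 : ℝ))) x
            (EuclideanSpace.single 0 (1 : ℝ)) +
          fderiv ℝ (fun y => fderiv ℝ (fun y' => U (-1) y' 2) y (EuclideanSpace.single 1 (1 : ℝ))) x
            (EuclideanSpace.single 1 (1 : ℝ))) := fun x hx =>
    plane_wave_identity hU2 (fun y => div_coord (hUdiv (-1) hm1) y) (hplane (x 2) hx) rfl
  have hlaww : ∀ x : EuclideanSpace ℝ (Fin 3), x 2 ∈ Ioo (-δ₂) δ₂ →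
      fderiv ℝ (fun y => fderiv ℝ w y (EuclideanSpace.single 2 (1 : ℝ))) x (EuclideanSpace.single 2 (1 : ℝ)) =
        -μ (-1) (x 2) * (fderiv ℝ (fun y => fderiv ℝ w y (EuclideanSpace.single 0 (1 : ℝ))) x (EuclideanSpace.single 0 (1 : ℝ)) +
          fderiv ℝ (fun y => fderiv ℝ w y (EuclideanSpace.single 1 (1 : ℝ))) x (EuclideanSpace.single 1 (1 : ℝ))) := by
    intro x hx
    have hxρ : |x 2| < ρ := (hwin _ hx).2.1
    have hxτ : (x + τ) 2 = x 2 := by simp [hτh]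
    have h1 := hlawθ x hxρ
    have h2 := hlawθ (x + τ) (by rw [hxτ]; exact hxρ)
    rw [hxτ] at h2
    rw [hw_def, nested_translate_sub hθ2, nested_translate_sub hθ2, nested_translate_sub hθ2, h1, h2]
    ring
  /- STEP 5: zero Cauchy data on the parallel-web sheet. -/
  have h0 : ∀ s : ℝ, ∀ z ∈ Ioo (-δ₂) δ₂, w (Γ s + d z • rotJ (deriv Γ s) + z • e2) = 0 := by
    intro s z hz
    simp only [hw_def]
    rw [← hPper, sub_eq_zero]
    exact mul_left_cancel₀ hσ0 (((hpar (s + L) z hz).1).trans ((hpar s z hz).1).symm)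
  -- the web Fermat law at the sheet point `(s, z)`
  have hAweb : ∀ s : ℝ, ∀ z ∈ Ioo (-δ₂) δ₂,
      fderiv ℝ (uncurry fun τ' y => σ * U (-1 + τ') y 2) (0, Γ s + d z • rotJ (deriv Γ s) + z • e2) =
        (fderiv ℝ (uncurry R) (0, z)).comp ((ContinuousLinearMap.fst ℝ ℝ (EuclideanSpace ℝ (Fin 3))).prod
          ((EuclideanSpace.proj (2 : Fin 3)).comp (ContinuousLinearMap.snd ℝ ℝ (EuclideanSpace ℝ (Fin 3))))) := by
    intro s z hz
    obtain ⟨n₁, hn₁, hval₁, -, -, hfd⟩ := hweb 0 z h0δ (habs.1 (hIδ hz)) s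
    simp only [add_zero] at hval₁
    rw [hνJ, show (EuclideanSpace.single 2 (1 : ℝ) : EuclideanSpace ℝ (Fin 3)) = e2 from rfl] at hval₁ hfd
    have hn : n₁ = d z := by
      by_contra hne
      exact absurd hval₁ ((hpar s z hz).2 n₁ (Ioo_subset_Icc_self hn₁) hne).ne
    rw [hn] at hfd
    exact hfd
  have h1 : ∀ s : ℝ, ∀ z ∈ Ioo (-δ₂) δ₂, fderiv ℝ w (Γ s + d z • rotJ (deriv Γ s) + z • e2) = 0 := by
    intro s z hz
    set P : EuclideanSpace ℝ (Fin 3) := Γ s + d z • rotJ (deriv Γ s) + z • e2 with hP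
    have hθd : Differentiable ℝ (fun y => U (-1) y 2) := hθ2.differentiable (by norm_num)
    have hτd' : DifferentiableAt ℝ (fun y => U (-1) (y + τ) 2) P := (hθd _).comp P (differentiableAt_id.add_const τ)
    have hsh : fderiv ℝ (fun y => U (-1) (y + τ) 2) P = fderiv ℝ (fun y => U (-1) y 2) (P + τ) :=
      fderiv_comp_add_right (f := fun y => U (-1) y 2) τ
    have hfw : fderiv ℝ w P = fderiv ℝ (fun y => U (-1) y 2) (P + τ) - fderiv ℝ (fun y => U (-1) y 2) P := by
      rw [hw_def, fderiv_fun_sub hτd' (hθd P), hsh]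
    rw [hfw, sub_eq_zero, ← hPper]
    -- both gradients: horizontal parts vanish, vertical parts agree (web Fermat law, same `A = DR(0,z)`)
    have hval : σ * U (-1 + 0) (Γ (s + L) + d z • rotJ (deriv Γ (s + L)) + z • e2) 2 = σ * U (-1 + 0) P 2 := by
      rw [add_zero, (hpar (s + L) z hz).1, (hpar s z hz).1]
    obtain ⟨-, -, hvert, -, -, -, -⟩ :=
      webData_of_fderiv_uncurry hUrate hUcont hUmild hUdiv hσ (τ₀ := 0) (by norm_num) (hAweb (s + L) z hz) (hAweb s z hz) hval
    simp only [add_zero] at hvert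
    refine clm_eq_of_apply_single fun i => ?_
    fin_cases i
    · rw [hhoriz (s + L) z hz _ (by simp), hhoriz s z hz _ (by simp)]
    · rw [hhoriz (s + L) z hz _ (by simp), hhoriz s z hz _ (by simp)]
    · simp only [Fin.reduceFinMk]
      rw [fderiv_apply_coord (U (-1)) (hUd _), fderiv_apply_coord (U (-1)) (hUd _)]
      exact hvert
  /- STEP 6: regularity of `d`, `R(0,·)` on the window; the characteristic form `Q = d′² + μ`. -/
  have hdon : ContDiffOn ℝ ∞ d (Ioo (-δ) δ) := fun z hz => (hdCD z (habs.1 hz)).contDiffWithinAt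
  have hd1on : ContDiffOn ℝ ∞ (deriv d) (Ioo (-δ) δ) := ((contDiffOn_infty_iff_deriv_of_isOpen isOpen_Ioo).1 hdon).2
  have hQc : ContinuousOn (fun z => deriv d z ^ 2 + μ (-1) z) (Ioo (-δ₂) δ₂) :=
    ((hd1on.continuousOn.mono hIδ).pow 2).add hμc.continuousOn
  have hJfac : ∀ s : ℝ, ∀ z ∈ Ioo (-δ₂) δ₂, 1 - k s * d z ≠ 0 := by
    intro s z hz h
    have hb := (hdwin z hz).2 s
    rw [abs_le] at hb
    linarith [hb.2]
  by_cases hA : ∃ z₀ ∈ Ioo (-δ₂) δ₂, deriv d z₀ ^ 2 + μ (-1) z₀ ≠ 0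
  · /- CASE (A): a non-characteristic height — Cauchy–Kovalevskaya across the curved sheet, then the periodic Liouville endgame. -/
    obtain ⟨z₀, hz₀, hQz₀⟩ := hA
    set J : Set ℝ := Ioo (-δ₂) δ₂ ∩ (fun z => deriv d z ^ 2 + μ (-1) z) ⁻¹' ({0}ᶜ) with hJ_def
    have hJo : IsOpen J := hQc.isOpen_inter_preimage isOpen_Ioo isOpen_compl_singleton
    have hz₀J : z₀ ∈ J := ⟨hz₀, hQz₀⟩
    have hJsub : J ⊆ Ioo (-δ₂) δ₂ := inter_subset_left
    have hdJ : ContDiffOn ℝ ∞ d J := hdon.mono (hJsub.trans hIδ)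
    have hev := eqOn_zero_nhds_of_sheet hwan hJo hdJ hΓc2 hΓ2 hΓunit hk (fun s z hz => hJfac s z (hJsub hz))
      (μ := μ (-1)) (fun x hx => hlaww x (hJsub hx)) (fun s z hz => h0 s z (hJsub hz)) (fun s z hz => h1 s z (hJsub hz))
      (fun z hz => hz.2) 0 hz₀J
    obtain ⟨V, hVsub, hVo, hPV⟩ := _root_.mem_nhds_iff.1 hev
    exact false_of_local_horizontalPeriod_slab hUrate hUcont hUmild hUdiv hUpol hUne hρ hslabU hτh hτ0 hVo ⟨_, hPV⟩
      fun x hx => by have h := hVsub hx; simpa [hw_def, sub_eq_zero] using h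
  · /- CASE (B): every height characteristic — `R″ ≡ 0` on `(−δ₂,δ₂)` by Huygens, `R(0,·)` affine there, and the sonic-curved cell applies. -/
    push Not at hA
    have hR'' : ∀ z ∈ Ioo (-δ₂) δ₂, deriv (deriv (R 0)) z = 0 := by
      intro z hz
      have h := hHuy z hz
      have hq := hA z hz
      have : deriv (deriv (R 0)) z = κf z * (deriv d z ^ 2 + μ (-1) z) := by linear_combination -h
      rw [this, hq, mul_zero]
    have hRon : ContDiffOn ℝ ∞ (R 0) (Ioo (-δ) δ) := fun z hz => (hRCD z (habs.1 hz)).contDiffWithinAt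
    have hR1on : ContDiffOn ℝ ∞ (deriv (R 0)) (Ioo (-δ) δ) := ((contDiffOn_infty_iff_deriv_of_isOpen isOpen_Ioo).1 hRon).2
    have hRd : ∀ z ∈ Ioo (-δ₂) δ₂, DifferentiableAt ℝ (R 0) z := fun z hz => (hRCD z (habs.1 (hIδ hz))).differentiableAt (by simp)
    have hR'd : ∀ z ∈ Ioo (-δ₂) δ₂, DifferentiableAt ℝ (deriv (R 0)) z := fun z hz =>
      (hR1on.contDiffAt (isOpen_Ioo.mem_nhds (hIδ hz))).differentiableAt (by simp)
    have h0mem : (0 : ℝ) ∈ Ioo (-δ₂) δ₂ := ⟨by linarith, hδ₂⟩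
    have haff := affine_of_deriv_deriv_eq_zero isOpen_Ioo isPreconnected_Ioo hRd hR'd hR'' h0mem
    have hson₂ : ∃ a b : ℝ, ∀ z : ℝ, |z| < δ₂ → R 0 z = a + b * z :=
      ⟨R 0 0, deriv (R 0) 0, fun z hz => by rw [haff z (habs.2 hz)]; ring⟩
    exact q4sonic_curved_core hUrate hUcont hUmild hUdiv hUpol hUne hUhotbd hUpeak hUcrit hσ hσN hκ hΓ hΓ0 hΓ2 hΓunit hΓhot hν hΓcurv hr hδ₂
      (fun τ' z hτ' hz => hconc τ' z (lt_of_lt_of_le hτ' hδ₂δ) (lt_of_lt_of_le hz hδ₂δ))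
      (fun τ₀ z₀ hτ₀ hz₀ => hweb τ₀ z₀ (lt_of_lt_of_le hτ₀ hδ₂δ) (lt_of_lt_of_le hz₀ hδ₂δ)) hρ hμ3 hslabU hevU hson₂ hcurved

/-- ★ **(Q4-CURVED), PERIODIC CURVATURE ⇒ `False`.**  The same with the period stated on the signed curvature `⟪Γ″, νΓ⟫` of the limit branch: periodic
curvature + properness of the limit branch (`limitBranch_injective_proper`) ⇒ a translation period (`exists_translation_period_of_tendsto`) ⇒
`q4curved_translation_core`. -/
theorem q4curved_periodic_core {C : ℝ} {U : ℝ → EuclideanSpace ℝ (Fin 3) → EuclideanSpace ℝ (Fin 3)} {Γ νΓ : ℝ → EuclideanSpace ℝ (Fin 3)}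
    {R μ : ℝ → ℝ → ℝ} {σ κ r δ ρ : ℝ}
    (hUrate : HasTypeITimeDecay C U) (hUcont : ContinuousOn (uncurry U) (Iio (0 : ℝ) ×ˢ univ))
    (hUmild : ∀ s t : ℝ, s < t → t < 0 → ∀ x, U t x = heatExtension (U s) (t - s) x - oseenDuhamel 1 s U U t x)
    (hUdiv : ∀ t < 0, VectorCalculus.IsDivFree (U t))
    (hUpol : ∀ s < 0, ∀ q, ⟪curl (U s) q, EuclideanSpace.single 2 1⟫_ℝ = 0)
    (hUne : U (-1) 0 2 ≠ 0) (hUhotbd : ∀ t < 0, ∀ x, Real.sqrt (-t) * |U t x 2| ≤ |U (-1) 0 2|)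
    (hUpeak : ∀ (s z₀ σ M : ℝ) (K O : Set (EuclideanSpace ℝ (Fin 3))), s < 0 →
      ((σ = 1 ∨ σ = -1) ∧ IsCompact K ∧ K.Nonempty ∧ (∀ q ∈ K, q 2 = z₀ ∧ σ * U s q 2 = M) ∧
        IsOpen O ∧ K ⊆ O ∧ (∀ q ∈ O, q 2 = z₀ → σ * U s q 2 ≤ M) ∧
        (∀ q ∈ O, q 2 = z₀ → σ * U s q 2 = M → q ∈ K)) → False)
    (hUcrit : ∀ y ∈ {y : EuclideanSpace ℝ (Fin 3) | y 2 = 0 ∧ U (-1) y 2 = U (-1) 0 2}, fderiv ℝ (fun x => U (-1) x 2) y = 0)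
    (hσ : σ = 1 ∨ σ = -1) (hσN : σ * U (-1) 0 2 = |U (-1) 0 2|) (hκ : 0 < κ)
    (hΓ : ContDiff ℝ ∞ Γ) (hΓ0 : Γ 0 = 0) (hΓ2 : ∀ s, Γ s 2 = 0) (hΓunit : ∀ s, ‖deriv Γ s‖ = 1) (hΓhot : ∀ s, U (-1) (Γ s) 2 = U (-1) 0 2)
    (hν : ∀ s, νΓ s = WithLp.toLp 2 ![-(deriv Γ s 1), deriv Γ s 0, 0])
    (hΓcurv : ∀ s, κ ≤ -(fderiv ℝ (fderiv ℝ (fun y => σ * U (-1) y 2)) (Γ s) (νΓ s) (νΓ s)))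
    (hr : 0 < r) (hδ : 0 < δ)
    (hconc : ∀ τ z : ℝ, |τ| < δ → |z| < δ → ∀ s : ℝ, ∀ n ∈ Ioo (-r) r,
      fderiv ℝ (fderiv ℝ (fun y => σ * U (-1 + τ) y 2)) (Γ s + n • νΓ s + z • EuclideanSpace.single 2 (1 : ℝ)) (νΓ s) (νΓ s) < 0)
    (hweb : ∀ τ₀ z₀ : ℝ, |τ₀| < δ → |z₀| < δ → ∀ s₀ : ℝ, ∃ n₀ ∈ Ioo (-r) r,
      σ * U (-1 + τ₀) (Γ s₀ + n₀ • νΓ s₀ + z₀ • EuclideanSpace.single 2 (1 : ℝ)) 2 = R τ₀ z₀ ∧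
      (∀ n ∈ Icc (-r) r, n ≠ n₀ → σ * U (-1 + τ₀) (Γ s₀ + n • νΓ s₀ + z₀ • EuclideanSpace.single 2 (1 : ℝ)) 2 < R τ₀ z₀) ∧
      DifferentiableAt ℝ (uncurry R) (τ₀, z₀) ∧
      fderiv ℝ (uncurry fun τ y => σ * U (-1 + τ) y 2) (τ₀, Γ s₀ + n₀ • νΓ s₀ + z₀ • EuclideanSpace.single 2 (1 : ℝ)) =
        (fderiv ℝ (uncurry R) (τ₀, z₀)).comp
          ((ContinuousLinearMap.fst ℝ ℝ (EuclideanSpace ℝ (Fin 3))).prod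
            ((EuclideanSpace.proj (2 : Fin 3)).comp (ContinuousLinearMap.snd ℝ ℝ (EuclideanSpace ℝ (Fin 3))))))
    (hρ : 0 < ρ) (hμ3 : ContDiff ℝ 3 (uncurry μ))
    (hslabU : ∀ t : ℝ, |t + 1| < ρ → ∀ x : EuclideanSpace ℝ (Fin 3), |x 2| < ρ → ∀ b : Fin 3, b ≠ 2 →
      fderiv ℝ (U t) x (EuclideanSpace.single 2 1) b = μ t (x 2) * fderiv ℝ (U t) x (EuclideanSpace.single b 1) 2)
    (hevU : ∀ t₀ : ℝ, |t₀ + 1| < ρ → ∀ y₀ : EuclideanSpace ℝ (Fin 3), y₀ 2 = 0 →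
      ∀ᶠ z in 𝓝 ((t₀, y₀) : ℝ × EuclideanSpace ℝ (Fin 3)), ∀ b : Fin 3, b ≠ 2 →
        fderiv ℝ (U z.1) z.2 (EuclideanSpace.single 2 1) b = μ z.1 (z.2 2) * fderiv ℝ (U z.1) z.2 (EuclideanSpace.single b 1) 2)
    (hcurved : ¬ (∀ s : ℝ, Γ s = s • deriv Γ 0))
    (hperk : ∃ L : ℝ, L ≠ 0 ∧ ∀ s, ⟪deriv (deriv Γ) (s + L), νΓ (s + L)⟫_ℝ = ⟪deriv (deriv Γ) s, νΓ s⟫_ℝ) : False := by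
  have hΓc2 : ContDiff ℝ 2 Γ := hΓ.of_le (by norm_cast)
  have hνJ : ∀ s, νΓ s = rotJ (deriv Γ s) := fun s => by rw [hν s]; rfl
  -- Frenet law with the signed curvature `k = ⟪Γ″, JΓ′⟫`
  have hk : ∀ s, deriv (deriv Γ) s = (fun s => ⟪deriv (deriv Γ) s, rotJ (deriv Γ s)⟫_ℝ) s • rotJ (deriv Γ s) := fun s =>
    deriv_deriv_eq_curvature_smul hΓc2 hΓ2 hΓunit s
  obtain ⟨L, hL, hperL⟩ := hperk
  have hperk' : ∀ s, (fun s => ⟪deriv (deriv Γ) s, rotJ (deriv Γ s)⟫_ℝ) (s + L) = (fun s => ⟪deriv (deriv Γ) s, rotJ (deriv Γ s)⟫_ℝ) s := by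
    intro s; simp only [← hνJ]; exact hperL s
  have hprop := (limitBranch_injective_proper hUrate hUcont hUmild hUdiv hUpol hUne hUhotbd hUpeak hUcrit hσ hσN hκ hΓc2 hΓ2 hΓunit hΓhot hν
    hΓcurv hρ hμ3 hevU).2.1
  obtain ⟨τ, -, -, hΓL, -⟩ := exists_translation_period_of_tendsto hΓc2 hΓ2 hΓunit hk hL hperk' hprop
  exact q4curved_translation_core hUrate hUcont hUmild hUdiv hUpol hUne hUhotbd hUpeak hUcrit hσ hσN hκ hΓ hΓ0 hΓ2 hΓunit hΓhot hν hΓcurv hr hδ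
    hconc hweb hρ hμ3 hslabU hevU hcurved ⟨L, τ, hL, hΓL⟩

end Summit.NavierStokesRegularity.NavierStokesRegularity.Theorems.PoloidalWindowDoorLrcModEntireQ4CurvedPeriodic

end
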